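import Mathlib
import Summits.NavierStokesRegularity.NavierStokesRegularity.Theorems.EulerZoomLiouvillePowerGaugeEulerLiouvillePastIrrotational
import Summits.NavierStokesRegularity.NavierStokesRegularity.Theorems.EulerZoomLiouvillePowerGaugeEulerLiouvilleSwirlfreeLedgerDecay
import Literature.Analysis.FluidPDE.ClassicalSolution
import Literature.Analysis.FluidPDE.VorticityCalculus
import Literature.Analysis.FluidPDE.AncientSimilarityVorticity
import Literature.Analysis.FluidPDE.FlatSwirlGauge
import HarnessLib

/-!
# Clock rigidity for shape-preserving Euler flows, part 2: the degenerate branch (curl homogeneity + the `E`-gauge)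
# (crux `EulerZoomLiouville.PowerGaugeEulerLiouville` = stmt-NavierStokesRegularity-19832; line `logtime-breathers` of ns-idea-11, stub T1
# `stub_clockRigidity`)

Route `EulerZoomLiouville` (NavierStokesRegularity); width seat ns-ezl-w4.  A shape-preserving member `u(τ, y) = θ(τ) V(y/ℓ(τ))` of the power-gauged
class satisfies, in `z = y/ℓ`, `α(τ) V + β(τ) (z·∇)V + (V·∇)V = ∇q_τ`.  If the coefficient pair `(α, β)` is NOT constant in `τ`, subtracting two
times gives a DEGENERATE RELATION `a V + b (z·∇)V = ∇Q` with `(a, b) ≠ (0, 0)`.  This file shows that such a member vanishes identically on the past: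

* `ClockRigidity.homogeneous_of_fderiv_apply_self` — Euler's theorem, converse: `DΩ(z)[z] = d Ω(z)` for all `z` ⇒ `Ω(tz) = t^d Ω(z)` (`t > 0`);
* `ClockRigidity.eq_zero_of_homogeneous_of_neg` — a continuous field positively homogeneous of NEGATIVE degree is zero (blow-up at the origin);
* `ClockRigidity.curl_eq_zero_or_homogeneous_of_radial` — taking the curl of `a V + b (z·∇)V = ∇Q` (`curl ((z·∇)V) = Ω + (z·∇)Ω`,
  `curl ∇Q = 0`): `b = 0` ⇒ `Ω := curl V ≡ 0`; `b ≠ 0` ⇒ `(z·∇)Ω = dΩ`, `d = −(a+b)/b`, so `Ω` is positively homogeneous of degree `d`;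
* `ClockRigidity.curl_slice` — `curl u(τ) (y) = (θ/ℓ) (curl V)(y/ℓ)`;
* `ClockRigidity.curl_profile_eq_zero_of_gaugeE` — THE `E`-GAUGE KILL: if `Ω` is homogeneous of degree `d ≥ 0` and `Ω(z₀) ≠ 0`, then `‖Ω‖ ≥ ε` on
  `B(a z₀, aδ)` for every `a ≥ 1`, so `‖curl u(τ)‖² ≥ (mε)²` on (a fixed time window) × `B(a z₀, aδ)`, whose volume is `~ a³`; but the `E`-gauge read on
  the classical gradient (`SwirlfreeLedger.setLIntegral_window_frobenius_fderiv_le`, `|curl|² ≤ 16 |∇u|²_F`) gives `≤ c (Ra)^{1−ρ}` — absurd for large `a`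
  (no homogeneous-polynomial structure of `Ω` is needed; this simplifies idea-crit-8's price P1⁗ for the line);
* `ClockRigidity.slice_eq_zero_of_degenerate` — conclusion: `curl V ≡ 0`, so every slice is `C²`, divergence free and irrotational, and the landed
  `PastIrrotational.slice_eq_zero_of_gaugeA` (`A`-gauge + harmonic Liouville with growth) gives `u(τ) = 0` for every `τ < 0` (`0 < ρ ≤ ½`).

WHAT THIS IS NOT: not NS, not E, not the crux — a helper `--supports` stmt-19832 (line `logtime-breathers`, stub T1); no summit statement is proved here.
[folklore; CaffarelliKohnNirenberg1982 §2 (the scaled dissipation `E`)]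
-/

noncomputable section

-- flat `Theorems/<Route><Decl>…` files of one crux share the namespace of the crux (tree convention: `Summit.<S>.<S>.…`)
set_option linter.dupNamespace false

open MeasureTheory Set Filter Topology Metric Function
open scoped NNReal ENNReal ContDiff

namespace Summit.NavierStokesRegularity.NavierStokesRegularity.Theorems.PowerGaugeEulerLiouville

open Literature.Analysis Literature.Analysis.FluidPDE

namespace ClockRigidity

/-! ### Positively homogeneous fields -/

/-- **Euler's homogeneous-function theorem, converse direction** (vector-valued): a differentiable field `Ω` on `ℝ³` with
`DΩ(z)[z] = d • Ω(z)` for all `z` is positively homogeneous of degree `d`: `Ω(t z) = t^d Ω(z)` for `t > 0` (the function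
`t ↦ t^{−d} Ω(tz)` has zero derivative on `(0, ∞)`). [folklore] -/
theorem homogeneous_of_fderiv_apply_self {Ω : EuclideanSpace ℝ (Fin 3) → EuclideanSpace ℝ (Fin 3)}
    (hΩ : Differentiable ℝ Ω) {d : ℝ} (h : ∀ z, fderiv ℝ Ω z z = d • Ω z) {t : ℝ} (ht : 0 < t)
    (z : EuclideanSpace ℝ (Fin 3)) : Ω (t • z) = t ^ d • Ω z := by
  -- `g(s) = s^{-d} • Ω(s z)` is constant on `(0, ∞)`
  have hg : ∀ s : ℝ, 0 < s → HasDerivAt (fun r : ℝ => r ^ (-d) • Ω (r • z)) 0 s := by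
    intro s hs
    have h1 : HasDerivAt (fun r : ℝ => r • z) z s := by
      simpa using (hasDerivAt_id s).smul_const z
    have h2 : HasDerivAt (fun r : ℝ => Ω (r • z)) (fderiv ℝ Ω (s • z) z) s :=
      (hΩ (s • z)).hasFDerivAt.comp_hasDerivAt s h1
    have h3 : HasDerivAt (fun r : ℝ => r ^ (-d)) (-d * s ^ (-d - 1)) s :=
      Real.hasDerivAt_rpow_const (Or.inl hs.ne')
    refine (h3.smul h2).congr_deriv ?_
    have h4 : fderiv ℝ Ω (s • z) z = (s⁻¹ * d) • Ω (s • z) := by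
      have h5 : fderiv ℝ Ω (s • z) (s • z) = d • Ω (s • z) := h (s • z)
      rw [map_smul] at h5
      rw [mul_smul, ← h5, inv_smul_smul₀ hs.ne']
    rw [h4, smul_smul, Real.rpow_sub_one hs.ne']
    have h6 : s ^ (-d) * (s⁻¹ * d) + -d * (s ^ (-d) / s) = 0 := by field_simp; ring
    rw [← add_smul, h6, zero_smul]
  have hconst : (fun r : ℝ => r ^ (-d) • Ω (r • z)) t = (fun r : ℝ => r ^ (-d) • Ω (r • z)) 1 :=
    isOpen_Ioi.is_const_of_deriv_eq_zero isPreconnected_Ioi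
      (fun s hs => (hg s hs).differentiableAt.differentiableWithinAt)
      (fun s hs => by simpa using (hg s hs).deriv) ht (show (1 : ℝ) ∈ Ioi 0 by norm_num)
  simp only [Real.one_rpow, one_smul] at hconst
  rw [← hconst, smul_smul, ← Real.rpow_add ht, add_neg_cancel, Real.rpow_zero, one_smul]

/-- A continuous field on `ℝ³` that is positively homogeneous of NEGATIVE degree vanishes identically: along the ray through `z`,
`‖Ω(tz)‖ = t^d ‖Ω(z)‖ → ∞` as `t → 0⁺` unless `Ω(z) = 0`, contradicting continuity at the origin. [folklore] -/
theorem eq_zero_of_homogeneous_of_neg {Ω : EuclideanSpace ℝ (Fin 3) → EuclideanSpace ℝ (Fin 3)}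
    (hΩ : Continuous Ω) {d : ℝ} (hd : d < 0) (hhom : ∀ t : ℝ, 0 < t → ∀ z, Ω (t • z) = t ^ d • Ω z)
    (z : EuclideanSpace ℝ (Fin 3)) : Ω z = 0 := by
  by_contra hz
  have hzpos : 0 < ‖Ω z‖ := norm_pos_iff.2 hz
  -- along the ray, the norm tends both to `‖Ω 0‖` and to `+∞`
  have hlim : Tendsto (fun t : ℝ => ‖Ω (t • z)‖) (𝓝[>] 0) (𝓝 ‖Ω ((0 : ℝ) • z)‖) := by
    have hc : Continuous fun t : ℝ => ‖Ω (t • z)‖ := (hΩ.comp (continuous_id.smul continuous_const)).norm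
    exact (hc.tendsto 0).mono_left nhdsWithin_le_nhds
  have htop : Tendsto (fun t : ℝ => t ^ d * ‖Ω z‖) (𝓝[>] 0) atTop :=
    (tendsto_rpow_neg_nhdsGT_zero hd).atTop_mul_const hzpos
  have heq : (fun t : ℝ => t ^ d * ‖Ω z‖) =ᶠ[𝓝[>] 0] fun t : ℝ => ‖Ω (t • z)‖ := by
    filter_upwards [self_mem_nhdsWithin] with t ht
    rw [hhom t ht z, norm_smul, Real.norm_eq_abs, abs_of_pos (Real.rpow_pos_of_pos ht d)]
  exact not_tendsto_atTop_of_tendsto_nhds hlim (htop.congr' heq)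

/-! ### The curl of a degenerate relation -/

/-- **Curl of a degenerate profile relation.**  Let `V ∈ C²(ℝ³; ℝ³)`, `Q ∈ C²(ℝ³)` and `a V + b (z·∇)V = ∇Q` on `ℝ³` with `(a, b) ≠ (0, 0)`.
Then either `curl V ≡ 0`, or `b ≠ 0` and `Ω = curl V` is positively homogeneous of degree `d = −(a+b)/b`:
`curl ((z·∇)V) = Ω + (z·∇)Ω` (`curl_fderiv_apply_self`) and `curl ∇Q = 0`, so `aΩ + b(Ω + (z·∇)Ω) = 0`; for `b = 0` this is `aΩ = 0` with
`a ≠ 0`, for `b ≠ 0` it is Euler's relation `(z·∇)Ω = dΩ` (`homogeneous_of_fderiv_apply_self`). [folklore] -/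
theorem curl_eq_zero_or_homogeneous_of_radial {V : EuclideanSpace ℝ (Fin 3) → EuclideanSpace ℝ (Fin 3)}
    (hV : ContDiff ℝ 2 V) {Q : EuclideanSpace ℝ (Fin 3) → ℝ} (hQ : ContDiff ℝ 2 Q) {a b : ℝ} (hab : a ≠ 0 ∨ b ≠ 0)
    (hrel : ∀ z, a • V z + b • fderiv ℝ V z z = gradient Q z) :
    (∀ z, curl V z = 0) ∨
      (b ≠ 0 ∧ ∀ t : ℝ, 0 < t → ∀ z, curl V (t • z) = t ^ (-(a + b) / b) • curl V z) := by
  have hVd : Differentiable ℝ V := hV.differentiable (by norm_num)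
  have hD : Differentiable ℝ (fderiv ℝ V) := (hV.fderiv_right (m := 1) (by norm_num)).differentiable one_ne_zero
  have hΩ1 : ContDiff ℝ 1 (curl V) := contDiff_curl (n := 1) (by exact_mod_cast hV)
  have hΩd : Differentiable ℝ (curl V) := hΩ1.differentiable one_ne_zero
  -- curl of both sides
  have hEQ : ∀ z, a • curl V z + b • (curl V z + fderiv ℝ (curl V) z z) = 0 := by
    intro z
    have hfun : (fun y => a • V y + b • fderiv ℝ V y y) = gradient Q := funext hrel
    have h1 : curl (fun y => a • V y + b • fderiv ℝ V y y) z = 0 := by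
      rw [hfun]; exact curl_gradient_eq_zero_holds Q hQ z
    have hdiff1 : DifferentiableAt ℝ (fun y => a • V y) z := (hVd z).const_smul a
    have hdiff2 : DifferentiableAt ℝ (fun y => fderiv ℝ V y y) z := (hD z).clm_apply differentiableAt_id
    have hdiff3 : DifferentiableAt ℝ (fun y => b • fderiv ℝ V y y) z := hdiff2.const_smul b
    rw [curl_add hdiff1 hdiff3, curl_const_smul (hVd z), curl_const_smul hdiff2,
      curl_fderiv_apply_self hV z] at h1
    exact h1
  by_cases hb : b = 0
  · left
    have ha : a ≠ 0 := hab.resolve_right (fun h => h hb)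
    intro z
    have := hEQ z
    rw [hb, zero_smul, add_zero] at this
    exact (smul_eq_zero.1 this).resolve_left ha
  · right
    refine ⟨hb, fun t ht z => homogeneous_of_fderiv_apply_self hΩd (fun w => ?_) ht z⟩
    have h1 : b • fderiv ℝ (curl V) w w = (-(a + b)) • curl V w := by
      linear_combination (norm := module) hEQ w
    calc fderiv ℝ (curl V) w w = b⁻¹ • (b • fderiv ℝ (curl V) w w) := by rw [inv_smul_smul₀ hb]
      _ = (-(a + b) / b) • curl V w := by rw [h1, smul_smul, div_eq_inv_mul]

/-! ### Slices of a shape-preserving member -/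

/-- The vorticity of a shape-preserving slice: `u(τ) = θ V(·/ℓ)` ⇒ `curl u(τ) (y) = (θ/ℓ) (curl V)(y/ℓ)` (`curl_smul_comp_smul`, no
differentiability needed). [folklore] -/
theorem curl_slice {u : ℝ → EuclideanSpace ℝ (Fin 3) → EuclideanSpace ℝ (Fin 3)} {θ ℓ : ℝ → ℝ}
    {V : EuclideanSpace ℝ (Fin 3) → EuclideanSpace ℝ (Fin 3)}
    (hu : ∀ τ : ℝ, τ < 0 → ∀ y, u τ y = θ τ • V ((ℓ τ)⁻¹ • y)) {τ : ℝ} (hτ : τ < 0) (y : EuclideanSpace ℝ (Fin 3)) :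
    curl (u τ) y = (θ τ * (ℓ τ)⁻¹) • curl V ((ℓ τ)⁻¹ • y) := by
  have hfun : u τ = fun w => θ τ • V ((ℓ τ)⁻¹ • w) := funext (hu τ hτ)
  rw [hfun]
  exact curl_smul_comp_smul V (θ τ) (ℓ τ)⁻¹ y

/-! ### The `E`-gauge kills homogeneous vorticity of nonnegative degree -/

/-- **`E`-GAUGE KILL.**  Let `(u, p)` be a classical Euler solution on `(−∞,0) × ℝ³` with a weak spatial gradient `H` on the slab obeying the `E`-gauge
`a^ρ E(a; 0; H) ≤ c` (`0 ≤ ρ`), and let `u(τ, y) = θ(τ) V(y/ℓ(τ))` (`τ < 0`) with positive clocks differentiable on `(−∞,0)` and a profile whose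
vorticity `Ω = curl V` is continuous and positively homogeneous of degree `d ≥ 0`.  Then `Ω ≡ 0`.  (If `Ω(z₀) ≠ 0`: `‖Ω‖ ≥ ε` on `B(z₀, δ)`, hence on
`B(a z₀, aδ)` for every `a ≥ 1` by homogeneity; by continuity of the clocks `θ ℓ^{−1−d} ≥ m > 0` on a time window `W` of length `2η` inside `(−1, 0)`;
so `|∇u|²_F ≥ ‖curl u‖²/16 ≥ (mε)²/16` on `W × B(a z₀, aδ)`, a set of volume `2η · (aδ)³ |B₁|` inside the window `Q(Ra)`, `R = ‖z₀‖ + 2`, where the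
`E`-gauge allows only `c (Ra)^{1−ρ} ≤ c R^{1−ρ} a` — impossible for large `a`.) [cite: CaffarelliKohnNirenberg1982, §2 (δ(r))] -/
theorem curl_profile_eq_zero_of_gaugeE {ρ : ℝ} (hρ : 0 ≤ ρ)
    {u : ℝ → EuclideanSpace ℝ (Fin 3) → EuclideanSpace ℝ (Fin 3)} {p : ℝ → EuclideanSpace ℝ (Fin 3) → ℝ}
    {H : ℝ → EuclideanSpace ℝ (Fin 3) → EuclideanSpace ℝ (Fin 3) →L[ℝ] EuclideanSpace ℝ (Fin 3)} {c : ℝ≥0}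
    (hH : HasWeakSpatialGradientOn (slab (EuclideanSpace ℝ (Fin 3)) (Iio 0) isOpen_Iio) u H)
    (hcl : IsClassicalEulerSolutionOn (Iio 0) 0 u p)
    (hE : ∀ a : ℝ, 0 < a → ENNReal.ofReal (a ^ ρ) * cknE a (0 : ℝ × EuclideanSpace ℝ (Fin 3)) H ≤ (c : ℝ≥0∞))
    {θ ℓ : ℝ → ℝ} {V : EuclideanSpace ℝ (Fin 3) → EuclideanSpace ℝ (Fin 3)}
    (hpos : ∀ τ : ℝ, τ < 0 → 0 < θ τ ∧ 0 < ℓ τ) (hθd : DifferentiableOn ℝ θ (Iio 0)) (hℓd : DifferentiableOn ℝ ℓ (Iio 0))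
    (hu : ∀ τ : ℝ, τ < 0 → ∀ y, u τ y = θ τ • V ((ℓ τ)⁻¹ • y))
    (hΩc : Continuous (curl V)) {d : ℝ} (hd : 0 ≤ d)
    (hhom : ∀ t : ℝ, 0 < t → ∀ z, curl V (t • z) = t ^ d • curl V z) :
    ∀ z, curl V z = 0 := by
  by_contra hne
  push Not at hne
  obtain ⟨z₀, hz₀⟩ := hne
  -- ### space: `‖curl V‖ > ε` on `B(z₀, δ)`
  set ε : ℝ := ‖curl V z₀‖ / 2 with hε
  have hεpos : 0 < ε := by rw [hε]; exact half_pos (norm_pos_iff.2 hz₀)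
  obtain ⟨δ₀, hδ₀, hδ₀ball⟩ := Metric.continuousAt_iff.1 (hΩc.continuousAt (x := z₀)) ε hεpos
  set δ : ℝ := min δ₀ 1 with hδ
  have hδpos : 0 < δ := lt_min hδ₀ zero_lt_one
  have hδ1 : δ ≤ 1 := min_le_right _ _
  have hball : ∀ w, dist w z₀ < δ → ε < ‖curl V w‖ := by
    intro w hw
    have h1 : dist (curl V w) (curl V z₀) < ε := hδ₀ball (lt_of_lt_of_le hw (min_le_left _ _))
    rw [dist_eq_norm] at h1
    have h2 : ‖curl V z₀‖ - ‖curl V w - curl V z₀‖ ≤ ‖curl V w‖ := by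
      have := norm_sub_norm_le (curl V z₀) (curl V z₀ - curl V w)
      rwa [sub_sub_cancel, norm_sub_rev (curl V z₀) (curl V w)] at this
    have h3 : ‖curl V z₀‖ = 2 * ε := by rw [hε]; ring
    linarith
  set R : ℝ := ‖z₀‖ + 2 with hR
  have hR1 : 1 ≤ R := by rw [hR]; linarith [norm_nonneg z₀]
  -- ### time: `θ ℓ^{-1} (ℓ^{-1})^d > m` on a window around `τ₀ = -1/2`
  set f : ℝ → ℝ := fun τ => θ τ * (ℓ τ)⁻¹ * ((ℓ τ)⁻¹) ^ d with hf
  have hτ₀ : (-(1 / 2 : ℝ)) < 0 := by norm_num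
  have hfpos : ∀ τ : ℝ, τ < 0 → 0 < f τ := fun τ hτ =>
    mul_pos (mul_pos (hpos τ hτ).1 (inv_pos.2 (hpos τ hτ).2)) (Real.rpow_pos_of_pos (inv_pos.2 (hpos τ hτ).2) d)
  have hfc : ContinuousAt f (-(1 / 2)) := by
    have hθc : ContinuousAt θ (-(1 / 2)) := (hθd.differentiableAt (Iio_mem_nhds hτ₀)).continuousAt
    have hℓc : ContinuousAt ℓ (-(1 / 2)) := (hℓd.differentiableAt (Iio_mem_nhds hτ₀)).continuousAt
    have hℓi : ContinuousAt (fun τ => (ℓ τ)⁻¹) (-(1 / 2)) := hℓc.inv₀ (hpos _ hτ₀).2.ne'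
    exact (hθc.mul hℓi).mul (hℓi.rpow_const (Or.inr hd))
  set m : ℝ := f (-(1 / 2)) / 2 with hm
  have hmpos : 0 < m := by rw [hm]; exact half_pos (hfpos _ hτ₀)
  obtain ⟨η₀, hη₀, hη₀f⟩ := Metric.continuousAt_iff.1 hfc m hmpos
  set η : ℝ := min η₀ (1 / 4) with hη
  have hηpos : 0 < η := lt_min hη₀ (by norm_num)
  have hη4 : η ≤ 1 / 4 := min_le_right _ _
  have hwin : ∀ τ : ℝ, τ ∈ Ioo (-(1 / 2) - η) (-(1 / 2) + η) → τ < 0 ∧ m < f τ := by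
    intro τ hτ
    rw [mem_Ioo] at hτ
    refine ⟨by linarith, ?_⟩
    have h1 : dist τ (-(1 / 2)) < η₀ := by
      rw [Real.dist_eq, abs_lt]; constructor <;> linarith [min_le_left η₀ (1 / 4)]
    have h2 := hη₀f h1
    rw [Real.dist_eq, abs_lt] at h2
    rw [hm]; linarith
  -- ### the unit-ball volume
  set v₁ : ℝ≥0∞ := volume (ball (0 : EuclideanSpace ℝ (Fin 3)) 1) with hv₁
  have hv₁pos : 0 < v₁.toReal := ENNReal.toReal_pos (measure_ball_pos volume _ zero_lt_one).ne' measure_ball_lt_top.ne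
  -- ### the contradiction at a large scale `a`
  set K : ℝ := (m * ε) ^ 2 / 16 * (2 * η) * δ ^ 3 * v₁.toReal with hK
  have hKpos : 0 < K := by rw [hK]; positivity
  set C₁ : ℝ := (c : ℝ) * R ^ (1 - ρ) with hC₁
  set a : ℝ := max 1 (C₁ / K + 1) with ha
  have ha1 : 1 ≤ a := le_max_left _ _
  have hapos : 0 < a := lt_of_lt_of_le zero_lt_one ha1
  -- the test set and the window
  set S : Set (ℝ × EuclideanSpace ℝ (Fin 3)) := Ioo (-(1 / 2) - η) (-(1 / 2) + η) ×ˢ ball (a • z₀) (a * δ) with hS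
  have hSm : MeasurableSet S := measurableSet_Ioo.prod measurableSet_ball
  have hSsub : S ⊆ Ioo (-(R * a) ^ 2) 0 ×ˢ ball (0 : EuclideanSpace ℝ (Fin 3)) (R * a) := by
    refine prod_mono (fun τ hτ => ?_) (fun y hy => ?_)
    · rw [mem_Ioo] at hτ ⊢
      have hRa : 1 ≤ R * a := one_le_mul_of_one_le_of_one_le hR1 ha1
      constructor <;> nlinarith
    · rw [mem_ball, dist_eq_norm] at hy
      rw [mem_ball, dist_zero_right]
      have h1 : ‖y‖ ≤ ‖y - a • z₀‖ + ‖a • z₀‖ := norm_le_norm_sub_add y (a • z₀)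
      rw [norm_smul, Real.norm_eq_abs, abs_of_pos hapos] at h1
      have h2 : a * δ ≤ a * 1 := mul_le_mul_of_nonneg_left hδ1 hapos.le
      rw [hR]; nlinarith
  -- pointwise lower bound on `S`
  have hpt : ∀ q ∈ S, ENNReal.ofReal ((m * ε) ^ 2 / 16) ≤
      ENNReal.ofReal (frobeniusNormSq (fderiv ℝ (u q.1) q.2)) := by
    rintro ⟨τ, y⟩ hq
    rw [hS, mem_prod] at hq
    obtain ⟨hτ0, hmf⟩ := hwin τ hq.1
    have hy : dist y (a • z₀) < a * δ := mem_ball.1 hq.2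
    refine ENNReal.ofReal_le_ofReal ?_
    -- `‖curl u(τ) y‖ ≥ m ε`
    have hθτ := (hpos τ hτ0).1
    have hℓτ := (hpos τ hτ0).2
    set w : EuclideanSpace ℝ (Fin 3) := a⁻¹ • y with hw
    have hwball : dist w z₀ < δ := by
      rw [hw, dist_eq_norm, show a⁻¹ • y - z₀ = a⁻¹ • (y - a • z₀) by rw [smul_sub, inv_smul_smul₀ hapos.ne'],
        norm_smul, Real.norm_eq_abs, abs_of_pos (inv_pos.2 hapos)]
      rw [dist_eq_norm] at hy
      calc a⁻¹ * ‖y - a • z₀‖ < a⁻¹ * (a * δ) := mul_lt_mul_of_pos_left hy (inv_pos.2 hapos)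
        _ = δ := by field_simp
    have hcurl : curl (u τ) y = (θ τ * (ℓ τ)⁻¹ * ((ℓ τ)⁻¹) ^ d * a ^ d) • curl V w := by
      rw [curl_slice hu hτ0 y, hhom _ (inv_pos.2 hℓτ) y,
        show y = a • w by rw [hw, smul_inv_smul₀ hapos.ne'], hhom a hapos w, smul_smul, smul_smul]
    have hnorm : m * ε ≤ ‖curl (u τ) y‖ := by
      rw [hcurl, norm_smul, Real.norm_eq_abs, abs_of_pos (mul_pos (hfpos τ hτ0) (Real.rpow_pos_of_pos hapos d))]
      have h1 : 1 ≤ a ^ d := Real.one_le_rpow ha1 hd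
      have h2 : ε ≤ ‖curl V w‖ := (hball w hwball).le
      calc m * ε = m * 1 * ε := by ring
        _ ≤ f τ * a ^ d * ‖curl V w‖ :=
            mul_le_mul (mul_le_mul hmf.le h1 zero_le_one (hfpos τ hτ0).le) h2 hεpos.le
              (mul_nonneg (hfpos τ hτ0).le (Real.rpow_nonneg hapos.le d))
    have hsq : (m * ε) ^ 2 ≤ ‖curl (u τ) y‖ ^ 2 := pow_le_pow_left₀ (by positivity) hnorm 2
    have h16 := SwirlfreeLedger.sq_norm_curl_le_frobeniusNormSq (u τ) y
    linarith
  -- lower bound for the window integral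
  have hlow : ENNReal.ofReal ((m * ε) ^ 2 / 16) * volume S ≤
      ∫⁻ q in S, ENNReal.ofReal (frobeniusNormSq (fderiv ℝ (u q.1) q.2)) := by
    rw [← setLIntegral_const]
    exact setLIntegral_mono' hSm hpt
  have hvolS : volume S = ENNReal.ofReal (2 * η) * (ENNReal.ofReal ((a * δ) ^ 3) * v₁) := by
    rw [hS, Measure.volume_eq_prod, Measure.prod_prod, Real.volume_Ioo,
      Measure.addHaar_ball volume _ (by positivity : (0 : ℝ) ≤ a * δ), finrank_euclideanSpace_fin]
    congr 2
    ring
  -- upper bound from the `E`-gauge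
  have hup : ∫⁻ q in S, ENNReal.ofReal (frobeniusNormSq (fderiv ℝ (u q.1) q.2)) ≤
      ENNReal.ofReal ((c : ℝ) * (R * a) ^ (1 - ρ)) :=
    le_trans (lintegral_mono_set hSsub)
      (SwirlfreeLedger.setLIntegral_window_frobenius_fderiv_le hH hcl hE (mul_pos (by linarith) hapos))
  have hchain := le_trans hlow hup
  rw [hvolS] at hchain
  -- convert to reals
  have hv₁eq : v₁ = ENNReal.ofReal v₁.toReal := (ENNReal.ofReal_toReal measure_ball_lt_top.ne).symm
  rw [hv₁eq, ← ENNReal.ofReal_mul (by positivity), ← ENNReal.ofReal_mul (by positivity),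
    ← ENNReal.ofReal_mul (by positivity)] at hchain
  have hreal := (ENNReal.ofReal_le_ofReal_iff (by positivity)).1 hchain
  -- `K a³ ≤ C₁ a`
  have hpow : (R * a) ^ (1 - ρ) ≤ R ^ (1 - ρ) * a := by
    rw [Real.mul_rpow (by linarith) hapos.le]
    have : a ^ (1 - ρ) ≤ a ^ (1 : ℝ) := Real.rpow_le_rpow_of_exponent_le ha1 (by linarith)
    rw [Real.rpow_one] at this
    exact mul_le_mul_of_nonneg_left this (Real.rpow_nonneg (by linarith) _)
  have h1 : K * a ^ 3 ≤ C₁ * a := by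
    have h2 : (m * ε) ^ 2 / 16 * (2 * η * ((a * δ) ^ 3 * v₁.toReal)) = K * a ^ 3 := by rw [hK]; ring
    calc K * a ^ 3 = (m * ε) ^ 2 / 16 * (2 * η * ((a * δ) ^ 3 * v₁.toReal)) := h2.symm
      _ ≤ (c : ℝ) * (R * a) ^ (1 - ρ) := hreal
      _ ≤ (c : ℝ) * (R ^ (1 - ρ) * a) := mul_le_mul_of_nonneg_left hpow c.2
      _ = C₁ * a := by rw [hC₁]; ring
  have h3 : K * a ^ 2 ≤ C₁ := by
    have h4 : K * a ^ 2 * a ≤ C₁ * a := by nlinarith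
    exact le_of_mul_le_mul_right h4 hapos
  have h5 : C₁ / K + 1 ≤ a := le_max_right _ _
  have h6 : C₁ < K * a := by
    have : K * (C₁ / K + 1) ≤ K * a := mul_le_mul_of_nonneg_left h5 hKpos.le
    rw [mul_add, mul_div_cancel₀ _ hKpos.ne', mul_one] at this
    linarith
  have h7 : K * a ≤ K * a ^ 2 := by
    have : a ≤ a ^ 2 := by nlinarith
    exact mul_le_mul_of_nonneg_left this hKpos.le
  linarith

/-! ### The degenerate branch: every slice vanishes -/

/-- **DEGENERATE BRANCH OF CLOCK RIGIDITY.**  A member of the power-gauged ancient Euler class (`0 < ρ ≤ ½`; `A`- and `E`-gauges, weak gradient `H`)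
that is a classical Euler solution on the past and shape-preserving, `u(τ, y) = θ(τ) V(y/ℓ(τ))` with a `C²` profile satisfying a DEGENERATE RELATION
`a V + b (z·∇)V = ∇Q` (`(a,b) ≠ (0,0)`, `Q ∈ C²`), vanishes at every past time: `u(τ) = 0` for all `τ < 0`.  (By `curl_eq_zero_or_homogeneous_of_radial`
the profile vorticity is zero or homogeneous of some degree `d`; `d < 0` is excluded by `eq_zero_of_homogeneous_of_neg`, `d ≥ 0` by the `E`-gauge kill
`curl_profile_eq_zero_of_gaugeE`; so every slice is `C²`, divergence free and irrotational, and `PastIrrotational.slice_eq_zero_of_gaugeA` concludes.)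
[folklore] -/
theorem slice_eq_zero_of_degenerate {ρ : ℝ} (hρ : 0 < ρ) (hρ2 : ρ ≤ 1 / 2)
    {u : ℝ → EuclideanSpace ℝ (Fin 3) → EuclideanSpace ℝ (Fin 3)} {p : ℝ → EuclideanSpace ℝ (Fin 3) → ℝ}
    {H : ℝ → EuclideanSpace ℝ (Fin 3) → EuclideanSpace ℝ (Fin 3) →L[ℝ] EuclideanSpace ℝ (Fin 3)} {c : ℝ≥0}
    (hH : HasWeakSpatialGradientOn (slab (EuclideanSpace ℝ (Fin 3)) (Iio 0) isOpen_Iio) u H)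
    (hcl : IsClassicalEulerSolutionOn (Iio 0) 0 u p)
    (hA : ∀ a : ℝ, 0 < a → ENNReal.ofReal (a ^ (2 * ρ)) * cknA a (0 : ℝ × EuclideanSpace ℝ (Fin 3)) u ≤ (c : ℝ≥0∞))
    (hE : ∀ a : ℝ, 0 < a → ENNReal.ofReal (a ^ ρ) * cknE a (0 : ℝ × EuclideanSpace ℝ (Fin 3)) H ≤ (c : ℝ≥0∞))
    {θ ℓ : ℝ → ℝ} {V : EuclideanSpace ℝ (Fin 3) → EuclideanSpace ℝ (Fin 3)}
    (hpos : ∀ τ : ℝ, τ < 0 → 0 < θ τ ∧ 0 < ℓ τ) (hθd : DifferentiableOn ℝ θ (Iio 0)) (hℓd : DifferentiableOn ℝ ℓ (Iio 0))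
    (hu : ∀ τ : ℝ, τ < 0 → ∀ y, u τ y = θ τ • V ((ℓ τ)⁻¹ • y)) (hV : ContDiff ℝ 2 V)
    {Q : EuclideanSpace ℝ (Fin 3) → ℝ} (hQ : ContDiff ℝ 2 Q) {a b : ℝ} (hab : a ≠ 0 ∨ b ≠ 0)
    (hrel : ∀ z, a • V z + b • fderiv ℝ V z z = gradient Q z) {τ : ℝ} (hτ : τ < 0) : u τ = 0 := by
  have hΩc : Continuous (curl V) := continuous_curl (hV.of_le (by norm_num))
  -- the profile is irrotational
  have hΩ : ∀ z, curl V z = 0 := by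
    rcases curl_eq_zero_or_homogeneous_of_radial hV hQ hab hrel with h0 | ⟨hb, hhom⟩
    · exact h0
    · rcases lt_or_ge (-(a + b) / b) 0 with hneg | hnn
      · exact eq_zero_of_homogeneous_of_neg hΩc hneg hhom
      · exact curl_profile_eq_zero_of_gaugeE hρ.le hH hcl hE hpos hθd hℓd hu hΩc hnn hhom
  -- so is every slice; conclude by the `A`-gauge Liouville
  have hcurl : ∀ x, curl (u τ) x = 0 := fun x => by rw [curl_slice hu hτ x, hΩ, smul_zero]
  have hC2 : ContDiff ℝ 2 (u τ) := (hcl.contDiff_velocity hτ).of_le (by norm_cast)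
  exact PastIrrotational.slice_eq_zero_of_gaugeA hρ hρ2 hA hτ hC2 (hcl.divFree τ hτ) hcurl

end ClockRigidity

end Summit.NavierStokesRegularity.NavierStokesRegularity.Theorems.PowerGaugeEulerLiouville

end
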